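import Summits.AtomisticToContinuum.BoseEinsteinCondensation.Theses.BECInfraredBound

/-!
# Sketch for crux idea `indicator-dictionary` on `BecDepletionSplit` (stmt-AtomisticToContinuum-9026)

Lever: every subtype-indexed `ℝ≥0∞` tsum over the lattice `ℤ³` is the full-lattice tsum of an
`ite`/indicator (`tsum_subtype`), so the split `Σ'_{k≠0} ≤ Σ'_{window} + Σ'_{tail}` is a POINTWISE
inequality of indicators summed with `ENNReal.tsum_add` / `ENNReal.tsum_le_tsum` — no set-union
coercions, no `Equiv` between subtypes, no summability side conditions, and the occupation
function stays OPAQUE (`f : ℤ³ → ℝ≥0∞` arbitrary). The other two registered stubs of the birth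
skeleton are closed by `θ⁺ = max θ 0` arithmetic and a `min/min` filter combinator.

First lemma of the line = `latticeTsumSplit` (verbatim the registered stub signature
`stub_latticeTsumSplit`). This file tries to PROVE all three stubs and the crux (cheapest
falsifier = `lean check` of this file).
-/

noncomputable section

open Filter
open scoped ENNReal NNReal BigOperators Classical

namespace Summit.AtomisticToContinuum.BoseEinsteinCondensation.Cruxes.BecDepletionSplit.IndicatorDictionary

open Literature.MathematicalPhysics.QuantumManyBody.BoseGas
open Summit.AtomisticToContinuum.BoseEinsteinCondensation.Theses.BECInfraredBound (BecDepletionSplit)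

/-! ## The dictionary: subtype tsum = full tsum of an `ite` -/

/-- A `tsum` over a subtype of `β` is the `tsum` over `β` of the summand cut off by the predicate.
[folklore] -/
theorem tsum_subtype_eq_tsum_ite {β : Type*} (p : β → Prop) (f : β → ℝ≥0∞) :
    ∑' x : {b // p b}, f x.1 = ∑' b, if p b then f b else 0 := by
  have h := tsum_subtype (f := f) {b | p b}
  simp only [Set.indicator_apply, Set.mem_setOf_eq] at h
  exact h

/-! ## Stub 1 (registered signature, verbatim): the lattice tsum split -/

/-- **Lattice tsum split** (= `stub_latticeTsumSplit` of `Lines/birth.lean`): for every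
`f : ℤ³ → ℝ≥0∞` and every real `R`, `Σ'_{k≠0} f ≤ Σ'_{k≠0, ‖k‖≤R} f + Σ'_{R<‖k‖} f`.
Proof: indicator dictionary + pointwise `le_or_lt`. [folklore] -/
theorem latticeTsumSplit :
    ∀ (f : (Fin 3 → ℤ) → ENNReal) (R : ℝ),
      ∑' k : {k : Fin 3 → ℤ // k ≠ 0}, f k.1 ≤
        (∑' k : {k : Fin 3 → ℤ // k ≠ 0 ∧ ‖(fun j => (k j : ℝ))‖ ≤ R}, f k.1) +
          ∑' k : {k : Fin 3 → ℤ // R < ‖(fun j => (k j : ℝ))‖}, f k.1 := by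
  intro f R
  rw [tsum_subtype_eq_tsum_ite (fun k : Fin 3 → ℤ => k ≠ 0) f,
    tsum_subtype_eq_tsum_ite (fun k : Fin 3 → ℤ => k ≠ 0 ∧ ‖(fun j => (k j : ℝ))‖ ≤ R) f,
    tsum_subtype_eq_tsum_ite (fun k : Fin 3 → ℤ => R < ‖(fun j => (k j : ℝ))‖) f,
    ← ENNReal.tsum_add]
  refine ENNReal.tsum_le_tsum fun k => ?_
  by_cases hk : k ≠ 0
  · rw [if_pos hk]
    rcases le_or_gt ‖(fun j => (k j : ℝ))‖ R with hle | hlt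
    · rw [if_pos ⟨hk, hle⟩]
      exact le_self_add
    · rw [if_pos hlt]
      exact le_add_self
  · rw [if_neg hk]
    exact zero_le

/-! ## Stub 2 (registered signature, verbatim): threshold arithmetic with the `θ ≤ 0` corner -/

/-- **Threshold combine** (= `stub_thresholdCombine`): witnesses `η = (1 - θ⁺)/2`,
`θ' = (1 + θ⁺)/2`, `θ⁺ = max θ 0`. [folklore] -/
theorem thresholdCombine :
    ∀ θ : ℝ, θ < 1 → ∃ η : ℝ, 0 < η ∧ ∃ θ' : ℝ, θ' < 1 ∧ ∀ (N : ℕ) (a b : ENNReal),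
      a ≤ ENNReal.ofReal (η * N) → b ≤ ENNReal.ofReal (θ * N) → a + b ≤ ENNReal.ofReal (θ' * N) := by
  intro θ hθ
  have h0 : 0 ≤ max θ 0 := le_max_right _ _
  have h1 : max θ 0 < 1 := max_lt hθ one_pos
  refine ⟨(1 - max θ 0) / 2, by linarith, (1 + max θ 0) / 2, by linarith, ?_⟩
  intro N a b ha hb
  have hN : (0 : ℝ) ≤ N := Nat.cast_nonneg N
  have hb' : b ≤ ENNReal.ofReal (max θ 0 * N) :=
    hb.trans (ENNReal.ofReal_le_ofReal (mul_le_mul_of_nonneg_right (le_max_left _ _) hN))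
  calc a + b ≤ ENNReal.ofReal ((1 - max θ 0) / 2 * N) + ENNReal.ofReal (max θ 0 * N) :=
        add_le_add ha hb'
    _ = ENNReal.ofReal ((1 - max θ 0) / 2 * N + max θ 0 * N) :=
        (ENNReal.ofReal_add (mul_nonneg (by linarith) hN) (mul_nonneg h0 hN)).symm
    _ = ENNReal.ofReal ((1 + max θ 0) / 2 * N) := by
        congr 1
        ring

/-! ## Stub 3 (registered signature, verbatim): the near-minimiser clause combinator -/

/-- **Near-minimiser clause combinator** (= `stub_nearMinCombine`): `min` of the density
thresholds, `Filter.Eventually` intersection, `min` of the two `δ`'s. [folklore] -/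
theorem nearMinCombine :
    ∀ (v : ℝ → ENNReal)
      (P Q R : (ρ : ℝ) → (N : ℕ) → Literature.MathematicalPhysics.QuantumManyBody.BoseGas.TrialState N (Literature.MathematicalPhysics.QuantumManyBody.BoseGas.sideLength ρ N) → Prop),
      (∀ ρ N Ψ, P ρ N Ψ → Q ρ N Ψ → R ρ N Ψ) →
      (∃ ρ₀ : ℝ, 0 < ρ₀ ∧ ∀ ρ : ℝ, 0 < ρ → ρ < ρ₀ → ∀ᶠ N : ℕ in Filter.atTop, ∃ δ : ENNReal, 0 < δ ∧
        ∀ Ψ : Literature.MathematicalPhysics.QuantumManyBody.BoseGas.TrialState N (Literature.MathematicalPhysics.QuantumManyBody.BoseGas.sideLength ρ N),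
          Literature.MathematicalPhysics.QuantumManyBody.BoseGas.energy v Ψ ≤
              Literature.MathematicalPhysics.QuantumManyBody.BoseGas.groundStateEnergy v N (Literature.MathematicalPhysics.QuantumManyBody.BoseGas.sideLength ρ N) + δ →
            P ρ N Ψ) →
      (∃ ρ₀ : ℝ, 0 < ρ₀ ∧ ∀ ρ : ℝ, 0 < ρ → ρ < ρ₀ → ∀ᶠ N : ℕ in Filter.atTop, ∃ δ : ENNReal, 0 < δ ∧
        ∀ Ψ : Literature.MathematicalPhysics.QuantumManyBody.BoseGas.TrialState N (Literature.MathematicalPhysics.QuantumManyBody.BoseGas.sideLength ρ N),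
          Literature.MathematicalPhysics.QuantumManyBody.BoseGas.energy v Ψ ≤
              Literature.MathematicalPhysics.QuantumManyBody.BoseGas.groundStateEnergy v N (Literature.MathematicalPhysics.QuantumManyBody.BoseGas.sideLength ρ N) + δ →
            Q ρ N Ψ) →
      ∃ ρ₀ : ℝ, 0 < ρ₀ ∧ ∀ ρ : ℝ, 0 < ρ → ρ < ρ₀ → ∀ᶠ N : ℕ in Filter.atTop, ∃ δ : ENNReal, 0 < δ ∧
        ∀ Ψ : Literature.MathematicalPhysics.QuantumManyBody.BoseGas.TrialState N (Literature.MathematicalPhysics.QuantumManyBody.BoseGas.sideLength ρ N),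
          Literature.MathematicalPhysics.QuantumManyBody.BoseGas.energy v Ψ ≤
              Literature.MathematicalPhysics.QuantumManyBody.BoseGas.groundStateEnergy v N (Literature.MathematicalPhysics.QuantumManyBody.BoseGas.sideLength ρ N) + δ →
            R ρ N Ψ := by
  intro v P Q R hPQR hP hQ
  obtain ⟨ρ₁, hρ₁, h1⟩ := hP
  obtain ⟨ρ₂, hρ₂, h2⟩ := hQ
  refine ⟨min ρ₁ ρ₂, lt_min hρ₁ hρ₂, fun ρ hρ hρlt => ?_⟩
  filter_upwards [h1 ρ hρ (hρlt.trans_le (min_le_left _ _)),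
    h2 ρ hρ (hρlt.trans_le (min_le_right _ _))] with N hN1 hN2
  obtain ⟨δ₁, hδ₁, hΨ1⟩ := hN1
  obtain ⟨δ₂, hδ₂, hΨ2⟩ := hN2
  refine ⟨min δ₁ δ₂, lt_min hδ₁ hδ₂, fun Ψ hΨ => hPQR ρ N Ψ (hΨ1 Ψ ?_) (hΨ2 Ψ ?_)⟩
  · exact hΨ.trans (add_le_add le_rfl (min_le_left _ _))
  · exact hΨ.trans (add_le_add le_rfl (min_le_right _ _))

/-! ## The crux by name (composition copied from `Lines/birth.lean`, `BecDepletionSplit_of`) -/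

/-- The inner box `Λ'_ε = (εL, L - εL)³` (verbatim the set in the crux). [cite: LSSY2005, Ch. 5] -/
abbrev innerBox (ε L : ℝ) : Set (EuclideanSpace ℝ (Fin 3)) :=
  {x : EuclideanSpace ℝ (Fin 3) | ∀ j, x j ∈ Set.Ioo (ε * L) (L - ε * L)}

/-- The inner-box plane wave `φ'_k` (verbatim the mode in the crux). [cite: LSSY2005, Ch. 5] -/
abbrev innerMode (ε L : ℝ) (k : Fin 3 → ℤ) : EuclideanSpace ℝ (Fin 3) → ℂ :=
  (innerBox ε L).indicator fun x =>
    ((Real.sqrt (((1 - 2 * ε) * L) ^ 3))⁻¹ : ℂ) *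
      Complex.exp (Complex.I * ↑(2 * Real.pi / ((1 - 2 * ε) * L) * ∑ j, (k j : ℝ) * x j))

/-- **Candidate proof of the crux** `BecDepletionSplit` from the three lemmas above, following the
kernel-checked composition `Birth.BecDepletionSplit_of`. [cite: LSSY2005, Ch. 11 (11.26)–(11.27)] -/
theorem becDepletionSplit_candidate : BecDepletionSplit := by
  intro v hv hW hU
  obtain ⟨K, hK, θ, hθ, hUε⟩ := hU
  obtain ⟨η, hη, θ', hθ', hadd⟩ := thresholdCombine θ hθ
  refine ⟨θ', hθ', fun ε hε hε' => ?_⟩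
  refine nearMinCombine v _ _ _ ?_ (hW ε hε hε' K hK η hη) (hUε ε hε hε')
  intro ρ N Ψ hp hq
  exact le_trans
    (latticeTsumSplit (fun k => occupation N (innerMode ε (sideLength ρ N) k) Ψ.ψ)
      (K * Real.sqrt ρ * sideLength ρ N))
    (hadd N _ _ hp hq)

end Summit.AtomisticToContinuum.BoseEinsteinCondensation.Cruxes.BecDepletionSplit.IndicatorDictionary

end
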